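import Summits.QuantumFields.BalabanUV.Beta.D1BFx.LamCoeffMoments

/-!
# `BalabanUV.Beta.D1BFx.LamRowGlue` — road «BF-x» for binder row D1, slot (K), END row `hGrp gΛ` (G_Λ) of `RoadEndBFxTotalShellGroups` (p252741): THE CONSUMER GLUE —
# `LamCoeffMoments.blockAvg_M2_lamCoeffOf_eq_zero_of_zeroMomentum` AT THE ROAD'S LEFT KERNEL `A := KInv` (its decay and block-translation invariance DISCHARGED by
# `OneStepResolventKernel.decays_KInv` ∕ `shiftK_KInv`), and the two-word form of the row: `R = LamWord ν Nrν + LamWord μ Nrμ` (the Λ dictionary, an3-g53) + the partners'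
# covariance ∕ decay ∕ zero-momentum letters ⇒ `R = 0`

HONEST DEPENDENCY (cell records, verbatim): «continuum YM on T⁴ ⇐ BetaPertH ∧ nine spine estimates (0/9 proved); BetaPertH ⇐ (D1) ∧ (D4) ∧
CAP+tail; G-an2-4 gates asym, D1 and NE2/3/4.»  HONEST FRAMING (cell contract, verbatim): «discharging `BetaPertH` makes Bałaban's UV stability
UNCONDITIONAL — a real constructive-QFT result; it is NOT the continuum limit and NOT the Clay problem.»  THIS MODULE DISCHARGES NOTHING of (K),
of D1 or of the wall: [folklore] composition BY NAME.  The dictionary equation (`hdict`) and the partner letters (`hcovN`, `hNr`, `hZero`) are DISPLAYED hypotheses —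
`hZero` is `KernelWardInsertionZero.tsum_resp_eq_zero` (p252493) under the local covariance letters (W1)∕(W2′) of the typed objects.  No definition, no `def … : Prop`,
nothing cited, no wall binder instantiated, 0 sorry.  NOT D1, NOT BetaPertH, NOT continuum, NOT Clay.

ABSOLUTE RULE (cell charter, verbatim): «No internally-minted statement may enter as a cited fact. Every hypothesis is either kernel-proved in this
package or a verbatim quotation of a PUBLISHED theorem with page reference. The manuscript(s) under audit are NOT citable for their own disputed
steps — they are the thing under adjudication; programme-internal (2001/route/tribunal) claims are never citable.»

Unit `b2b-balaban-beta-d1-p2` (road owner, gen 9); `K-CLOSURE-PLAN-R1L.md` §8 (ρ-g9-16).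
-/

noncomputable section

open Finset Filter Topology
open scoped BigOperators
open Literature.MathematicalPhysics.QuantumFieldTheory.Balaban1983to89
open Literature.MathematicalPhysics.QuantumFieldTheory.Balaban1983to89.Beta
open B12Sec2to5 (l1)
open ExpKernelCalculus (Decays MKer shiftK)
open OneStepResolventKernel (Fib KInv decays_KInv shiftK_KInv)
open AffineAveraging (Site box toSite)
open BalabanStepJets (lamCoeffOf)
open Summit.QuantumFields.BalabanUV.Beta.D1BFx.LamCoeffMoments (blockAvg_M2_lamCoeffOf_eq_zero_of_zeroMomentum blockAvg_M0_lamCoeffOf_eq_zero)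

namespace Summit.QuantumFields.BalabanUV.Beta.D1BFx.LamRowGlue

variable {d N : ℕ} [NeZero N]

/-- [folklore] **THE Λ′⊗X WORD OF THE ROAD VANISHES IN THE BLOCK-AVERAGED SECOND MOMENT, AT `A := KInv`**, given only the PARTNER's letters: block covariance
`hcovN`, exponential localisation `hNr`, and the zero-momentum letter `hZero` (`Σ'_{u′} Nr m 0 u′ = 0`).  (`decays_KInv` and `shiftK_KInv` discharge the left kernel's hypotheses of
`LamCoeffMoments.blockAvg_M2_lamCoeffOf_eq_zero_of_zeroMomentum`.) -/
theorem lamWord_KInv_eq_zero_of_zeroMomentum (κ' α β : Fin (d + 1))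
    (Nr : Fin (d + 1) → Site (d + 1) → Site (d + 1) → ℝ) {C' δ' : ℝ} (hδ' : 0 < δ')
    (hcovN : ∀ m y t u', Nr m (y + t) (u' + (N : ℤ) • t) = Nr m y u')
    (hNr : ∀ m y u, |Nr m y u| ≤ C' * Real.exp (-δ' * l1 ((N : ℤ) • y - u)))
    (hZero : ∀ m : Fin (d + 1), ∑' u' : Site (d + 1), Nr m 0 u' = 0) :
    ((N : ℝ) ^ (d + 1))⁻¹ * ∑ b ∈ box (d + 1) N, ∑' u', ((((u' - toSite b) α : ℤ) : ℝ) * (((u' - toSite b) β : ℤ) : ℝ))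
        * (∑ m, ∑' y, lamCoeffOf (KInv (N := N) (d := d)) N m y κ' (toSite b) * Nr m y u') = 0 := by
  obtain ⟨δ, C, hδ, hC, hA⟩ := decays_KInv (N := N) (d := d)
  exact blockAvg_M2_lamCoeffOf_eq_zero_of_zeroMomentum hA hC hδ (fun t => shiftK_KInv (N := N) (d := d) t) κ' α β Nr hδ' hcovN hNr hZero

/-- [folklore] The zeroth-moment companion at `A := KInv` (no zero-momentum letter needed). -/
theorem lamWord₀_KInv_eq_zero (κ' : Fin (d + 1))
    (Nr : Fin (d + 1) → Site (d + 1) → Site (d + 1) → ℝ) {C' δ' : ℝ} (hδ' : 0 < δ')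
    (hcovN : ∀ m y t u', Nr m (y + t) (u' + (N : ℤ) • t) = Nr m y u')
    (hNr : ∀ m y u, |Nr m y u| ≤ C' * Real.exp (-δ' * l1 ((N : ℤ) • y - u))) :
    ((N : ℝ) ^ (d + 1))⁻¹ * ∑ b ∈ box (d + 1) N, ∑' u', (∑ m, ∑' y, lamCoeffOf (KInv (N := N) (d := d)) N m y κ' (toSite b) * Nr m y u') = 0 := by
  obtain ⟨δ, C, hδ, hC, hA⟩ := decays_KInv (N := N) (d := d)
  exact blockAvg_M0_lamCoeffOf_eq_zero hA hC hδ (fun t => shiftK_KInv (N := N) (d := d) t) κ' Nr hδ' hcovN hNr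

/-- [folklore] **THE G_Λ ROW VANISHES, MODULO THE DICTIONARY AND THE PARTNER LETTERS** (the consumer of an3-g53's (DICT) `R = LamWord ν Nrν + LamWord μ Nrμ`): for any real `R`
(:= the END's group-Λ row at blocking `N`, channel `(μ, ν)`), the dictionary equation plus, for each of the two partner functionals, block covariance, exponential localisation and the
zero-momentum letter, give `R = 0` — i.e. `hGrp gΛ` of `RoadEndBFxTotalShellGroups.d1Drift_BFx_total_shell_of_prop12_of_groups` with constant `0`. -/
theorem gLam_row_eq_zero_of_dict (μ ν : Fin (d + 1)) (R : ℝ)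
    (Nrν Nrμ : Fin (d + 1) → Site (d + 1) → Site (d + 1) → ℝ) {Cν δν Cμ δμ : ℝ} (hδν : 0 < δν) (hδμ : 0 < δμ)
    (hdict : R =
      ((N : ℝ) ^ (d + 1))⁻¹ * ∑ b ∈ box (d + 1) N, ∑' u', ((((u' - toSite b) μ : ℤ) : ℝ) * (((u' - toSite b) ν : ℤ) : ℝ))
          * (∑ m, ∑' y, lamCoeffOf (KInv (N := N) (d := d)) N m y ν (toSite b) * Nrν m y u')
      + ((N : ℝ) ^ (d + 1))⁻¹ * ∑ b ∈ box (d + 1) N, ∑' u', ((((u' - toSite b) μ : ℤ) : ℝ) * (((u' - toSite b) ν : ℤ) : ℝ))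
          * (∑ m, ∑' y, lamCoeffOf (KInv (N := N) (d := d)) N m y μ (toSite b) * Nrμ m y u'))
    (hcovν : ∀ m y t u', Nrν m (y + t) (u' + (N : ℤ) • t) = Nrν m y u')
    (hNrν : ∀ m y u, |Nrν m y u| ≤ Cν * Real.exp (-δν * l1 ((N : ℤ) • y - u)))
    (hZeroν : ∀ m : Fin (d + 1), ∑' u' : Site (d + 1), Nrν m 0 u' = 0)
    (hcovμ : ∀ m y t u', Nrμ m (y + t) (u' + (N : ℤ) • t) = Nrμ m y u')
    (hNrμ : ∀ m y u, |Nrμ m y u| ≤ Cμ * Real.exp (-δμ * l1 ((N : ℤ) • y - u)))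
    (hZeroμ : ∀ m : Fin (d + 1), ∑' u' : Site (d + 1), Nrμ m 0 u' = 0) :
    R = 0 := by
  rw [hdict, lamWord_KInv_eq_zero_of_zeroMomentum ν μ ν Nrν hδν hcovν hNrν hZeroν,
    lamWord_KInv_eq_zero_of_zeroMomentum μ μ ν Nrμ hδμ hcovμ hNrμ hZeroμ, add_zero]

/-- [folklore] The same with the ABSOLUTE-VALUE conclusion the END row consumes: `|R| ≤ 0`. -/
theorem abs_gLam_row_le_zero_of_dict (μ ν : Fin (d + 1)) (R : ℝ)
    (Nrν Nrμ : Fin (d + 1) → Site (d + 1) → Site (d + 1) → ℝ) {Cν δν Cμ δμ : ℝ} (hδν : 0 < δν) (hδμ : 0 < δμ)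
    (hdict : R =
      ((N : ℝ) ^ (d + 1))⁻¹ * ∑ b ∈ box (d + 1) N, ∑' u', ((((u' - toSite b) μ : ℤ) : ℝ) * (((u' - toSite b) ν : ℤ) : ℝ))
          * (∑ m, ∑' y, lamCoeffOf (KInv (N := N) (d := d)) N m y ν (toSite b) * Nrν m y u')
      + ((N : ℝ) ^ (d + 1))⁻¹ * ∑ b ∈ box (d + 1) N, ∑' u', ((((u' - toSite b) μ : ℤ) : ℝ) * (((u' - toSite b) ν : ℤ) : ℝ))
          * (∑ m, ∑' y, lamCoeffOf (KInv (N := N) (d := d)) N m y μ (toSite b) * Nrμ m y u'))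
    (hcovν : ∀ m y t u', Nrν m (y + t) (u' + (N : ℤ) • t) = Nrν m y u')
    (hNrν : ∀ m y u, |Nrν m y u| ≤ Cν * Real.exp (-δν * l1 ((N : ℤ) • y - u)))
    (hZeroν : ∀ m : Fin (d + 1), ∑' u' : Site (d + 1), Nrν m 0 u' = 0)
    (hcovμ : ∀ m y t u', Nrμ m (y + t) (u' + (N : ℤ) • t) = Nrμ m y u')
    (hNrμ : ∀ m y u, |Nrμ m y u| ≤ Cμ * Real.exp (-δμ * l1 ((N : ℤ) • y - u)))
    (hZeroμ : ∀ m : Fin (d + 1), ∑' u' : Site (d + 1), Nrμ m 0 u' = 0) :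
    |R| ≤ 0 := by
  rw [gLam_row_eq_zero_of_dict μ ν R Nrν Nrμ hδν hδμ hdict hcovν hNrν hZeroν hcovμ hNrμ hZeroμ, abs_zero]

end Summit.QuantumFields.BalabanUV.Beta.D1BFx.LamRowGlue

end
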